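import Summits.Ventures.Crystal3D.Theorems.StickyWulffConstantNoReconstructionGainCubicFrame
import Literature.MathematicalPhysics.StatisticalMechanics.BarlowCoordination
import HarnessLib

/-!
# Co-axial pairs: the shared Barlow frame pins both grains, in-plane periods, quantised heights

HONEST FRAMING. Part of the venture `Summits/Ventures/Crystal3D` (cell `crystal3d-full`), helper
`--supports` the crux `CoaxialWallLaw` (stmt-Ventures-19481, `route-Ventures-StickyWulffConstant`),
REGISTERED line `WallLedgerF` (planner cf-p1 gen 16), stub `stub_coaxialTwoSlabAdhesion`.
Infrastructure only: what the crux's CO-AXIALITY hypothesis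

  `(A·Λ₀ + t) ⊆ (L·B(σ) + s)`,  `Λ₀ = fccStacking 1 √(2/3)`, `B(σ) = barlowStacking 1 √(2/3) σ`, `IsHaggSeq σ`

actually gives, in the tree's vocabulary:

* `movedFcc_eq_barlowImage` — the inclusion is an EQUALITY of point sets (the Barlow stacking is
  a unit packing, `le_dist_of_mem_barlowStacking_ideal`, and the moved fcc lattice has covering
  radius `1/√2 < 1`, `exists_fcc_dist_sq_le_half`), so each grain IS the `L`-image of a Barlow
  stacking;
* `barlowImage_add_inPlane_mem` / `coaxial_inPlane_slot_mem` — the three in-plane bond classes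
  `±L u₁, ±L u₂, ±L(u₂ − u₁)` (`u₁ = triangularVec₁ 1`, `u₂ = triangularVec₂ 1`) are PERIOD
  VECTORS of `L·B(σ) + s`, hence of both grains of a co-axial pair: the six in-plane slots of every
  ball of either grain are sites of its own grain (terraces break no in-plane bond line; the
  riser ledger counts the in-plane lines that the wall does break — `…CoaxialWallLawTilt`);
* `barlowImage_inner_axis_sub` — HEIGHT QUANTISATION along the shared axis `m = L e₃`:
  `⟪x − x', m⟫ ∈ √(2/3)·ℤ` for any two sites of `L·B(σ) + s` (used by the ribbon lemmas of the
  absorption inequality: two foreign partners of a host ball differ in height by a multiple of the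
  layer spacing);
* `movedFcc_add_site_mem`, `movedFcc_exists_dist_sq_le_half`, `barlowImage_one_le_dist` —
  plumbing (lattice closure, covering radius, packing property under the rigid motion).

WHAT THIS IS NOT: no deficiency estimate; the stub and the crux are untouched; rung F-C1 not moved.
-/

noncomputable section

namespace Summit.Ventures.Crystal3D.Theorems

open Summit.Ventures.Crystal3D
open Literature.MathematicalPhysics.StatisticalMechanics (barlowPos barlowStacking fccStacking
  constHagg IsHaggSeq haggLabel barlowPos_mem triangularVec₁ triangularVec₂ barlowOffset layerNormal
  le_dist_of_mem_barlowStacking_ideal barlowPos_apply_two)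
open scoped InnerProductSpace

/-! ## The model lattice is closed under its own translations -/

/-- `Λ₀` is closed under addition of sites (it is a lattice containing `0`). -/
theorem fcc_add_site_mem {p w : EuclideanSpace ℝ (Fin 3)}
    (hp : p ∈ fccStacking 1 (Real.sqrt (2 / 3))) (hw : w ∈ fccStacking 1 (Real.sqrt (2 / 3))) :
    p + w ∈ fccStacking 1 (Real.sqrt (2 / 3)) := by
  obtain ⟨k, i, j, rfl⟩ := hp
  obtain ⟨k', i', j', rfl⟩ := hw
  refine ⟨k + k', i + i', j + j', ?_⟩
  rw [barlowPos_fcc_linear 1 _ k, barlowPos_fcc_linear 1 _ k', barlowPos_fcc_linear 1 _ (k + k')]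
  push_cast
  module

/-- `Λ₀` is closed under subtraction of sites. -/
theorem fcc_sub_site_mem {p w : EuclideanSpace ℝ (Fin 3)}
    (hp : p ∈ fccStacking 1 (Real.sqrt (2 / 3))) (hw : w ∈ fccStacking 1 (Real.sqrt (2 / 3))) :
    p - w ∈ fccStacking 1 (Real.sqrt (2 / 3)) := by
  obtain ⟨k, i, j, rfl⟩ := hp
  obtain ⟨k', i', j', rfl⟩ := hw
  exact ⟨k - k', i - i', j - j', barlowPos_fcc_sub k i j k' i' j'⟩

/-- **Slot sites belong to the grain.**  For a moved lattice `A·Λ₀ + t`: if `x ∈ A·Λ₀ + t` and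
`w ∈ Λ₀` then `x + A w ∈ A·Λ₀ + t`. -/
theorem movedFcc_add_site_mem
    (A : EuclideanSpace ℝ (Fin 3) ≃ₗᵢ[ℝ] EuclideanSpace ℝ (Fin 3)) (t : EuclideanSpace ℝ (Fin 3))
    {x w : EuclideanSpace ℝ (Fin 3)}
    (hx : x ∈ (fun p => A p + t) '' fccStacking 1 (Real.sqrt (2 / 3)))
    (hw : w ∈ fccStacking 1 (Real.sqrt (2 / 3))) :
    x + A w ∈ (fun p => A p + t) '' fccStacking 1 (Real.sqrt (2 / 3)) := by
  obtain ⟨p, hp, rfl⟩ := hx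
  refine ⟨p + w, fcc_add_site_mem hp hw, ?_⟩
  simp only [map_add]
  abel

/-- Same with subtraction: `x − A w ∈ A·Λ₀ + t`. -/
theorem movedFcc_sub_site_mem
    (A : EuclideanSpace ℝ (Fin 3) ≃ₗᵢ[ℝ] EuclideanSpace ℝ (Fin 3)) (t : EuclideanSpace ℝ (Fin 3))
    {x w : EuclideanSpace ℝ (Fin 3)}
    (hx : x ∈ (fun p => A p + t) '' fccStacking 1 (Real.sqrt (2 / 3)))
    (hw : w ∈ fccStacking 1 (Real.sqrt (2 / 3))) :
    x - A w ∈ (fun p => A p + t) '' fccStacking 1 (Real.sqrt (2 / 3)) := by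
  obtain ⟨p, hp, rfl⟩ := hx
  refine ⟨p - w, fcc_sub_site_mem hp hw, ?_⟩
  simp only [map_sub]
  abel

/-- **Covering radius of a moved lattice**: every point is within squared distance `1/2` of
`A·Λ₀ + t`. -/
theorem movedFcc_exists_dist_sq_le_half
    (A : EuclideanSpace ℝ (Fin 3) ≃ₗᵢ[ℝ] EuclideanSpace ℝ (Fin 3)) (t q : EuclideanSpace ℝ (Fin 3)) :
    ∃ z ∈ (fun p => A p + t) '' fccStacking 1 (Real.sqrt (2 / 3)), dist q z ^ 2 ≤ 1 / 2 := by
  obtain ⟨z₀, hz₀, hd⟩ := exists_fcc_dist_sq_le_half (A.symm (q - t))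
  refine ⟨A z₀ + t, ⟨z₀, hz₀, rfl⟩, ?_⟩
  have e1 : dist (A.symm (q - t)) z₀ = dist (q - t) (A z₀) := by
    conv_lhs => rw [show z₀ = A.symm (A z₀) by simp]
    exact A.symm.dist_map _ _
  have e2 : dist q (A z₀ + t) = dist (q - t) (A z₀) := by
    rw [dist_eq_norm, dist_eq_norm]; congr 1; abel
  rw [e2, ← e1, dist_eq_norm]; exact hd

/-! ## The `L`-image of an ideal Barlow stacking is a unit packing -/

/-- `(√(2/3))² = 2/3 · 1²` (the ideal layer spacing). -/
theorem barlow_ideal_height_sq : Real.sqrt (2 / 3) ^ 2 = 2 / 3 * (1 : ℝ) ^ 2 := by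
  rw [Real.sq_sqrt (by norm_num)]; ring

/-- Distinct sites of `L·B(σ) + s` are at distance `≥ 1` (`σ` a Hägg sequence). -/
theorem barlowImage_one_le_dist
    (L : EuclideanSpace ℝ (Fin 3) ≃ₗᵢ[ℝ] EuclideanSpace ℝ (Fin 3)) (s : EuclideanSpace ℝ (Fin 3))
    {σ : ℤ → ℤ} (hσ : IsHaggSeq σ) {x y : EuclideanSpace ℝ (Fin 3)}
    (hx : x ∈ (fun p => L p + s) '' barlowStacking 1 (Real.sqrt (2 / 3)) σ)
    (hy : y ∈ (fun p => L p + s) '' barlowStacking 1 (Real.sqrt (2 / 3)) σ) (hxy : x ≠ y) :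
    1 ≤ dist x y := by
  obtain ⟨p, hp, rfl⟩ := hx
  obtain ⟨p', hp', rfl⟩ := hy
  have hpp' : p ≠ p' := fun h => hxy (by rw [h])
  have h := le_dist_of_mem_barlowStacking_ideal hσ one_pos barlow_ideal_height_sq hp hp' hpp'
  have e : dist (L p + s) (L p' + s) = dist p p' := by rw [dist_add_right, L.dist_map]
  simpa [e] using h

/-- **Co-axiality pins the grain**: if the moved fcc lattice `A·Λ₀ + t` is CONTAINED in the image
`L·B(σ) + s` of an ideal Barlow stacking, the two point sets are EQUAL (a unit packing cannot
contain a point within distance `< 1` of a lattice of covering radius `1/√2` without containing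
it as a site). -/
theorem movedFcc_eq_barlowImage
    (A : EuclideanSpace ℝ (Fin 3) ≃ₗᵢ[ℝ] EuclideanSpace ℝ (Fin 3)) (t : EuclideanSpace ℝ (Fin 3))
    (L : EuclideanSpace ℝ (Fin 3) ≃ₗᵢ[ℝ] EuclideanSpace ℝ (Fin 3)) (s : EuclideanSpace ℝ (Fin 3))
    {σ : ℤ → ℤ} (hσ : IsHaggSeq σ)
    (hsub : (fun p => A p + t) '' fccStacking 1 (Real.sqrt (2 / 3)) ⊆
      (fun p => L p + s) '' barlowStacking 1 (Real.sqrt (2 / 3)) σ) :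
    (fun p => A p + t) '' fccStacking 1 (Real.sqrt (2 / 3)) =
      (fun p => L p + s) '' barlowStacking 1 (Real.sqrt (2 / 3)) σ := by
  refine Set.Subset.antisymm hsub ?_
  intro b hb
  obtain ⟨z, hz, hd⟩ := movedFcc_exists_dist_sq_le_half A t b
  by_cases hbz : b = z
  · rw [hbz]; exact hz
  · exfalso
    have h1 := barlowImage_one_le_dist L s hσ hb (hsub hz) hbz
    nlinarith [h1, hd, dist_nonneg (x := b) (y := z)]

/-! ## In-plane periods -/

/-- Shifting the first in-layer index: `barlowPos a h σ k (i+1) j = barlowPos a h σ k i j + u₁`. -/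
theorem barlowPos_succ_i (a h : ℝ) (σ : ℤ → ℤ) (k i j : ℤ) :
    barlowPos a h σ k (i + 1) j = barlowPos a h σ k i j + triangularVec₁ a := by
  simp only [barlowPos]
  push_cast
  module

/-- Shifting the second in-layer index: `barlowPos a h σ k i (j+1) = barlowPos a h σ k i j + u₂`. -/
theorem barlowPos_succ_j (a h : ℝ) (σ : ℤ → ℤ) (k i j : ℤ) :
    barlowPos a h σ k i (j + 1) = barlowPos a h σ k i j + triangularVec₂ a := by
  simp only [barlowPos]
  push_cast
  module

/-- **The in-plane classes are periods of `L·B(σ) + s`.**  For every site `x` and all integers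
`i, j`: `x + L (i•u₁ + j•u₂) ∈ L·B(σ) + s`. -/
theorem barlowImage_add_inPlane_mem
    (L : EuclideanSpace ℝ (Fin 3) ≃ₗᵢ[ℝ] EuclideanSpace ℝ (Fin 3)) (s : EuclideanSpace ℝ (Fin 3))
    (σ : ℤ → ℤ) {x : EuclideanSpace ℝ (Fin 3)}
    (hx : x ∈ (fun p => L p + s) '' barlowStacking 1 (Real.sqrt (2 / 3)) σ) (i j : ℤ) :
    x + L ((i : ℝ) • triangularVec₁ 1 + (j : ℝ) • triangularVec₂ 1) ∈
      (fun p => L p + s) '' barlowStacking 1 (Real.sqrt (2 / 3)) σ := by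
  obtain ⟨p, ⟨k, i₀, j₀, rfl⟩, rfl⟩ := hx
  refine ⟨barlowPos 1 (Real.sqrt (2 / 3)) σ k (i₀ + i) (j₀ + j), barlowPos_mem _ _ _, ?_⟩
  have e : barlowPos 1 (Real.sqrt (2 / 3)) σ k (i₀ + i) (j₀ + j) =
      barlowPos 1 (Real.sqrt (2 / 3)) σ k i₀ j₀ + ((i : ℝ) • triangularVec₁ 1 + (j : ℝ) • triangularVec₂ 1) := by
    simp only [barlowPos]
    push_cast
    module
  simp only [e, map_add]
  abel

/-- **In-plane slots of a co-axial grain are its own sites.**  Under the crux's co-axiality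
hypothesis for the grain `Λ = A·Λ₀ + t` with frame `(L, s, σ)`, for every `x ∈ Λ` the six points
`x ± L u₁`, `x ± L u₂`, `x ± L (u₂ − u₁)` lie in `Λ`. -/
theorem coaxial_inPlane_slot_mem
    (A : EuclideanSpace ℝ (Fin 3) ≃ₗᵢ[ℝ] EuclideanSpace ℝ (Fin 3)) (t : EuclideanSpace ℝ (Fin 3))
    (L : EuclideanSpace ℝ (Fin 3) ≃ₗᵢ[ℝ] EuclideanSpace ℝ (Fin 3)) (s : EuclideanSpace ℝ (Fin 3))
    {σ : ℤ → ℤ} (hσ : IsHaggSeq σ)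
    (hsub : (fun p => A p + t) '' fccStacking 1 (Real.sqrt (2 / 3)) ⊆
      (fun p => L p + s) '' barlowStacking 1 (Real.sqrt (2 / 3)) σ)
    {x : EuclideanSpace ℝ (Fin 3)} (hx : x ∈ (fun p => A p + t) '' fccStacking 1 (Real.sqrt (2 / 3)))
    (i j : ℤ) :
    x + L ((i : ℝ) • triangularVec₁ 1 + (j : ℝ) • triangularVec₂ 1) ∈
      (fun p => A p + t) '' fccStacking 1 (Real.sqrt (2 / 3)) := by
  rw [movedFcc_eq_barlowImage A t L s hσ hsub] at hx ⊢
  exact barlowImage_add_inPlane_mem L s σ hx i j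

/-- The in-plane generators are unit vectors at mutual inner product `½`:
`‖u₁‖ = 1`, `‖u₂‖ = 1`, `‖u₂ − u₁‖ = 1`. -/
theorem norm_triangularVec_one :
    ‖triangularVec₁ (1 : ℝ)‖ = 1 ∧ ‖triangularVec₂ (1 : ℝ)‖ = 1 ∧
      ‖triangularVec₂ (1 : ℝ) - triangularVec₁ 1‖ = 1 := by
  have h3 : Real.sqrt 3 ^ 2 = 3 := Real.sq_sqrt (by norm_num)
  have hsq : ∀ v : EuclideanSpace ℝ (Fin 3), ‖v‖ ^ 2 = v 0 ^ 2 + v 1 ^ 2 + v 2 ^ 2 := by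
    intro v
    rw [EuclideanSpace.norm_sq_eq, Fin.sum_univ_three]
    simp only [Real.norm_eq_abs, sq_abs]
  have a0 : triangularVec₁ (1 : ℝ) 0 = 1 := by simp [triangularVec₁]
  have a1 : triangularVec₁ (1 : ℝ) 1 = 0 := by simp [triangularVec₁]
  have a2 : triangularVec₁ (1 : ℝ) 2 = 0 := by simp [triangularVec₁]
  have b0 : triangularVec₂ (1 : ℝ) 0 = 1 / 2 := by simp [triangularVec₂]
  have b1 : triangularVec₂ (1 : ℝ) 1 = Real.sqrt 3 / 2 := by simp [triangularVec₂]
  have b2 : triangularVec₂ (1 : ℝ) 2 = 0 := by simp [triangularVec₂]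
  have n1 : ‖triangularVec₁ (1 : ℝ)‖ ^ 2 = 1 := by
    rw [hsq, a0, a1, a2]; norm_num
  have n2 : ‖triangularVec₂ (1 : ℝ)‖ ^ 2 = 1 := by
    rw [hsq, b0, b1, b2]; nlinarith [h3]
  have n3 : ‖triangularVec₂ (1 : ℝ) - triangularVec₁ 1‖ ^ 2 = 1 := by
    rw [hsq]
    simp only [PiLp.sub_apply, a0, a1, a2, b0, b1, b2]
    nlinarith [h3]
  refine ⟨?_, ?_, ?_⟩
  · nlinarith [norm_nonneg (triangularVec₁ (1 : ℝ))]
  · nlinarith [norm_nonneg (triangularVec₂ (1 : ℝ))]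
  · nlinarith [norm_nonneg (triangularVec₂ (1 : ℝ) - triangularVec₁ 1)]

/-! ## Height quantisation along the shared axis -/

/-- **Heights along the axis are quantised.**  Two sites of `L·B(σ) + s` differ, along the axis
`m = L e₃`, by an integer multiple of the layer spacing `√(2/3)`. -/
theorem barlowImage_inner_axis_sub
    (L : EuclideanSpace ℝ (Fin 3) ≃ₗᵢ[ℝ] EuclideanSpace ℝ (Fin 3)) (s : EuclideanSpace ℝ (Fin 3))
    (σ : ℤ → ℤ) {x x' : EuclideanSpace ℝ (Fin 3)}
    (hx : x ∈ (fun p => L p + s) '' barlowStacking 1 (Real.sqrt (2 / 3)) σ)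
    (hx' : x' ∈ (fun p => L p + s) '' barlowStacking 1 (Real.sqrt (2 / 3)) σ) :
    ∃ n : ℤ, ⟪x - x', L (EuclideanSpace.single (2 : Fin 3) (1 : ℝ))⟫_ℝ = n * Real.sqrt (2 / 3) := by
  obtain ⟨p, ⟨k, i, j, rfl⟩, rfl⟩ := hx
  obtain ⟨p', ⟨k', i', j', rfl⟩, rfl⟩ := hx'
  refine ⟨k - k', ?_⟩
  have e : L (barlowPos 1 (Real.sqrt (2 / 3)) σ k i j) + s - (L (barlowPos 1 (Real.sqrt (2 / 3)) σ k' i' j') + s) =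
      L (barlowPos 1 (Real.sqrt (2 / 3)) σ k i j - barlowPos 1 (Real.sqrt (2 / 3)) σ k' i' j') := by
    rw [map_sub]; abel
  rw [e, LinearIsometryEquiv.inner_map_map, EuclideanSpace.inner_single_right]
  simp only [PiLp.sub_apply, barlowPos_apply_two]
  simp
  ring

end Summit.Ventures.Crystal3D.Theorems

end
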